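import Summits.NavierStokesRegularity.NavierStokesRegularity.Theorems.TypeILiouvilleTypeIliouvilleNoTypeIITypeIIZoomPackage
import Summits.NavierStokesRegularity.NavierStokesRegularity.Theorems.TypeILiouvilleTypeIliouvilleNoTypeIIStubEternalLiouvilleOfL
import HarnessLib

/-!
# Modulo KNSS's Liouville conjecture (L), the Type-II side of `NoTypeII` reduces to a scaled
# local ENERGY bound on the zoom limit (crux `TypeIliouvilleNoTypeII`, stmt-NavierStokesRegularity-0056)

Helper file (theorems only).  The RIGIDITY slot of the uniform Type-II-exclusion skeleton
(`TypeIIZoom.isTypeIBlowup_of_transfer_of_rigidity`, file `…TypeIIZoomPackage.lean`) asks, for a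
property `P` of bounded eternal Oseen-mild smooth divergence-free fields `v` (`‖v‖ ≤ 2`), that
`P v ⇒ v(0,0) = 0`.  The route `TypeILiouville` carries KNSS's Liouville conjecture (L) as its own
crux `TypeIliouvilleL` (stmt-NavierStokesRegularity-10661, a hard core), and (L) makes every such
`v` spatially CONSTANT on every slice (landed: `stub_eternalLiouville_of_liouvilleConjecture`).  So
modulo (L) the rigidity slot only has to kill CONSTANT flows, and the weakest scale-invariant
quantity that sees constants is the Caffarelli–Kohn–Nirenberg / Albritton–Barker scaled local
kinetic energy `A(v; Q_r(z)) = sup_{t ∈ (t₀ - r², t₀)} r⁻¹ ∫_{B_r(x₀)} |v(t)|²` (tree `cknA`): for a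
constant `c` it equals `|c|² |B₁| r²`, unbounded in `r`.  This file proves:

* `slice_const_of_fderiv_eq_zero` — a jointly smooth field with `∇v(t) ≡ 0` has constant slice
  `v(t)`;
* `slice_eq_zero_of_const_of_cknA_le` — a constant slice of a field whose `A` is bounded by some
  `I < ∞` on ALL parabolic balls vanishes (`|c|² |B₁| r² ≤ I` for all `r`);
* `eternal_eq_zero_of_liouvilleL_of_cknA_le` — RIGIDITY MODULO (L): under `TypeIliouvilleL`, a
  bounded eternal Oseen-mild smooth divergence-free field with `sup_{r, z} A(v; Q_r(z)) < ∞`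
  vanishes identically;
* `isTypeIBlowup_of_cknATransfer_of_liouvilleL`, `typeIliouvilleNoTypeII_of_cknATransfer_of_liouvilleL`
  — hence, per solution and for the crux BY NAME: (L) ∧ «the Type-II zoom limit of every
  non-Type-I maximal Leray–Hopf solution from rapidly decaying data inherits a uniform bound on `A`
  over all parabolic balls» ⇒ `NoTypeII`.

READING (for the D-0081 §B cell).  The critics' REACH lattice (KILLKIT §C: C1 centred local Type I,
C1′ Albritton–Barker `𝐈 < ∞`, C2 weak-`L³`, C3 = the pointwise rate of 0056) has the open
"Type-I upgrade" gaps C1′ ⇒ C3, C2 ⇒ C3.  MODULO (L) these gaps CLOSE through the zoom package, and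
already the `A`-component of C1′ suffices: a slab bound on `A(u; Q)` over the parabolic balls of a
final slab transfers to the package limit (`cknA_zoomLimit_le`, file `…TypeIIZoomFatou.lean`, plus the
scale covariance `cknA(w_j; Q_r(z)) = cknA(ũ; Q_{(ν/M_j) r}(Φ_j z))` of the tree's `…_nsZoom` lemmas),
and this file kills the limit.  What is NOT here: the transport identity itself (ns-typeII-p1's
announced inheritance kit) and any claim on (L) or on the a-priori `A`-bound — both OPEN.
-/

noncomputable section

-- the summit and its single problem share the name `NavierStokesRegularity` (D-0017 nested layout)
set_option linter.dupNamespace false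

open Set Function Filter Topology MeasureTheory Metric
open scoped NNReal ENNReal

namespace Summit.NavierStokesRegularity.NavierStokesRegularity.Theorems.TypeIliouvilleNoTypeII.TypeIIZoom

open Literature.Analysis Literature.Analysis.FluidPDE
open Summit.NavierStokesRegularity.NavierStokesRegularity.Theorems.TypeIliouvilleNoTypeII.ImmortalZoom
open Summit.NavierStokesRegularity.NavierStokesRegularity.Theses.TypeILiouville (TypeIliouvilleL
  TypeIliouvilleNoTypeII)

variable {v : ℝ → EuclideanSpace ℝ (Fin 3) → EuclideanSpace ℝ (Fin 3)}

/-! ## Constant slices and the scaled local energy -/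

/-- A jointly smooth field whose slice `v(t)` has vanishing gradient everywhere has a constant
slice: `v(t, x) = v(t, 0)`. [folklore] -/
theorem slice_const_of_fderiv_eq_zero (hv : ContDiff ℝ (⊤ : ℕ∞) (uncurry v)) {t : ℝ}
    (h0 : ∀ x, fderiv ℝ (v t) x = 0) (x : EuclideanSpace ℝ (Fin 3)) : v t x = v t 0 :=
  is_const_of_fderiv_eq_zero ((hv.comp (contDiff_prodMk_right t)).differentiable (by simp)) h0 x 0

/-- The scaling constant of the energy of a constant on a ball: `r⁻¹ · r³ = r²` in `ℝ≥0∞`, `r > 0`.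
[folklore] -/
theorem inv_ofReal_mul_ofReal_pow_three {r : ℝ} (hr : 0 < r) :
    (ENNReal.ofReal r)⁻¹ * ENNReal.ofReal (r ^ 3) = ENNReal.ofReal (r ^ 2) := by
  have hr0 : ENNReal.ofReal r ≠ 0 := by simpa using hr
  rw [ENNReal.ofReal_pow hr.le, ENNReal.ofReal_pow hr.le, pow_succ' (ENNReal.ofReal r) 2,
    ← mul_assoc, ENNReal.inv_mul_cancel hr0 ENNReal.ofReal_ne_top, one_mul]

/-- **The scaled local energy of a constant slice**: if `v(t, ·) ≡ v(t, 0)` and `r > 0`, then for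
the parabolic ball `Q_r(z)` with `z = (t + r²/2, 0)` (so that `t ∈ (z.1 - r², z.1)`),
`‖v(t,0)‖² · |B₁| · r² ≤ A(v; Q_r(z))`. [folklore] -/
theorem enorm_sq_mul_le_cknA_of_const {t : ℝ} (hconst : ∀ x, v t x = v t 0) {r : ℝ} (hr : 0 < r) :
    ‖v t 0‖ₑ ^ (2 : ℕ) * volume (ball (0 : EuclideanSpace ℝ (Fin 3)) 1) * ENNReal.ofReal (r ^ 2) ≤
      cknA r ((t + r ^ 2 / 2, 0) : ℝ × EuclideanSpace ℝ (Fin 3)) v := by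
  set z : ℝ × EuclideanSpace ℝ (Fin 3) := (t + r ^ 2 / 2, 0) with hz
  have hr2 : 0 < r ^ 2 := by positivity
  have ht : t ∈ Ioo (z.1 - r ^ 2) z.1 := ⟨by simp only [hz]; linarith, by simp only [hz]; linarith⟩
  have h1 : (ENNReal.ofReal r)⁻¹ * ∫⁻ y in ball z.2 r, ‖v t y‖ₑ ^ (2 : ℕ) ≤ cknA r z v := by
    unfold cknA
    exact le_iSup₂ (f := fun s (_ : s ∈ Ioo (z.1 - r ^ 2) z.1) =>
      (ENNReal.ofReal r)⁻¹ * ∫⁻ y in ball z.2 r, ‖v s y‖ₑ ^ (2 : ℕ)) t ht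
  have h2 : ∫⁻ y in ball z.2 r, ‖v t y‖ₑ ^ (2 : ℕ) =
      ‖v t 0‖ₑ ^ (2 : ℕ) * volume (ball (0 : EuclideanSpace ℝ (Fin 3)) r) := by
    have hf : (fun y => ‖v t y‖ₑ ^ (2 : ℕ)) = fun _ => ‖v t 0‖ₑ ^ (2 : ℕ) :=
      funext fun y => by rw [hconst y]
    rw [hf, setLIntegral_const]
  have h3 : volume (ball (0 : EuclideanSpace ℝ (Fin 3)) r) =
      ENNReal.ofReal (r ^ 3) * volume (ball (0 : EuclideanSpace ℝ (Fin 3)) 1) := by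
    rw [Measure.addHaar_ball_of_pos volume 0 hr, finrank_euclideanSpace_fin]
  calc ‖v t 0‖ₑ ^ (2 : ℕ) * volume (ball (0 : EuclideanSpace ℝ (Fin 3)) 1) * ENNReal.ofReal (r ^ 2)
      = (ENNReal.ofReal r)⁻¹ * (‖v t 0‖ₑ ^ (2 : ℕ) *
          (ENNReal.ofReal (r ^ 3) * volume (ball (0 : EuclideanSpace ℝ (Fin 3)) 1))) := by
        rw [← inv_ofReal_mul_ofReal_pow_three hr]; ring
    _ = (ENNReal.ofReal r)⁻¹ * ∫⁻ y in ball z.2 r, ‖v t y‖ₑ ^ (2 : ℕ) := by rw [h2, h3]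
    _ ≤ cknA r z v := h1

/-- **A constant slice of a field with uniformly bounded scaled local energy vanishes.**  If
`v(t, ·) ≡ v(t, 0)` and `A(v; Q_r(z)) ≤ I < ∞` for every parabolic ball, then `v(t, ·) ≡ 0`
(`‖v(t,0)‖² |B₁| r² ≤ I` for all `r > 0`). [folklore] -/
theorem slice_eq_zero_of_const_of_cknA_le {I : ℝ≥0∞} (hI : I < ⊤)
    (hA : ∀ r : ℝ, 0 < r → ∀ z : ℝ × EuclideanSpace ℝ (Fin 3), cknA r z v ≤ I) {t : ℝ}
    (hconst : ∀ x, v t x = v t 0) (x : EuclideanSpace ℝ (Fin 3)) : v t x = 0 := by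
  rw [hconst x]
  by_contra hv0
  set a : ℝ≥0∞ := ‖v t 0‖ₑ ^ (2 : ℕ) * volume (ball (0 : EuclideanSpace ℝ (Fin 3)) 1) with ha
  have ha0 : a ≠ 0 :=
    mul_ne_zero (pow_ne_zero _ (enorm_ne_zero.2 hv0)) (measure_ball_pos volume 0 one_pos).ne'
  have key : ∀ r : ℝ, 0 < r → a * ENNReal.ofReal (r ^ 2) ≤ I := fun r hr =>
    (enorm_sq_mul_le_cknA_of_const hconst hr).trans (hA r hr _)
  have hlim : Tendsto (fun r : ℝ => a * ENNReal.ofReal (r ^ 2)) atTop (𝓝 ⊤) := by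
    have h : Tendsto (fun r : ℝ => ENNReal.ofReal (r ^ 2)) atTop (𝓝 ⊤) :=
      ENNReal.tendsto_ofReal_atTop.comp (tendsto_pow_atTop two_ne_zero)
    have h' : Tendsto (fun r : ℝ => a * ENNReal.ofReal (r ^ 2)) atTop (𝓝 (a * ⊤)) :=
      ENNReal.Tendsto.const_mul h (Or.inl ENNReal.top_ne_zero)
    rwa [ENNReal.mul_top ha0] at h'
  obtain ⟨r, hIr, hr⟩ := ((hlim.eventually_const_lt hI).and (eventually_gt_atTop 0)).exists
  exact lt_irrefl I (hIr.trans_le (key r hr))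

/-- A jointly smooth field with identically vanishing spatial gradient and uniformly bounded scaled
local energy on all parabolic balls vanishes identically. [folklore] -/
theorem eternal_eq_zero_of_fderiv_eq_zero_of_cknA_le (hv : ContDiff ℝ (⊤ : ℕ∞) (uncurry v))
    (h0 : ∀ t x, fderiv ℝ (v t) x = 0) {I : ℝ≥0∞} (hI : I < ⊤)
    (hA : ∀ r : ℝ, 0 < r → ∀ z : ℝ × EuclideanSpace ℝ (Fin 3), cknA r z v ≤ I)
    (t : ℝ) (x : EuclideanSpace ℝ (Fin 3)) : v t x = 0 :=
  slice_eq_zero_of_const_of_cknA_le hI hA (slice_const_of_fderiv_eq_zero hv (h0 t)) x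

/-! ## Rigidity modulo (L) -/

/-- **RIGIDITY MODULO (L).**  Under KNSS's Liouville conjecture (L) (= the route item
`TypeIliouvilleL`, stmt-NavierStokesRegularity-10661), a bounded eternal Oseen-mild solution `v`
on `ℝ × ℝ³` — jointly smooth, divergence free, `v(t) = e^{(t-s)Δ}v(s) - B¹_s(v,v)(t)` for `s < t` —
whose scaled local energy is bounded on all parabolic balls, `A(v; Q_r(z)) ≤ I < ∞`, vanishes
identically: (L) makes every slice constant (`stub_eternalLiouville_of_liouvilleConjecture`), and a
constant with bounded `A` is zero. [cite: KochNadirashviliSereginSverak2009, §1 conjecture (L) and §6 Prop. 6.1 (arXiv:0709.3599)] -/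
theorem eternal_eq_zero_of_liouvilleL_of_cknA_le (hL : TypeIliouvilleL)
    (v : ℝ → EuclideanSpace ℝ (Fin 3) → EuclideanSpace ℝ (Fin 3))
    (hv : ContDiff ℝ (⊤ : ℕ∞) (uncurry v)) (hdiv : ∀ t, VectorCalculus.IsDivFree (v t))
    (hmild : ∀ s t : ℝ, s < t → ∀ x, v t x = heatFlow (v s) (t - s) x - oseenDuhamel 1 s v v t x)
    (hbdd : ∃ C : ℝ, ∀ t x, ‖v t x‖ ≤ C) {I : ℝ≥0∞} (hI : I < ⊤)
    (hA : ∀ r : ℝ, 0 < r → ∀ z : ℝ × EuclideanSpace ℝ (Fin 3), cknA r z v ≤ I) :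
    ∀ t x, v t x = 0 :=
  eternal_eq_zero_of_fderiv_eq_zero_of_cknA_le hv
    (stub_eternalLiouville_of_liouvilleConjecture hL v hv hdiv hmild hbdd) hI hA

/-! ## The Type-I rate and the crux, modulo (L) and an `A`-transfer -/

/-- **Per solution: (L) and an inherited `A`-bound on the Type-II zoom limit force the Type-I
rate.**  Let `(u, p)` be maximal with lifespan `T`, Leray–Hopf from a rapidly decaying datum.  If
the failure of the Type-I rate would make the limit `v` of its Type-II zoom package
(`exists_typeIIZoomPackage`) satisfy `A(v; Q_r(z)) ≤ I` for all parabolic balls and some `I < ∞`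
(the TRANSFER of an a-priori slab bound on the scaled local energy of `u`), then under (L) the
solution is Type I at `T`. [cite: KochNadirashviliSereginSverak2009, §6 Prop. 6.1 (arXiv:0709.3599 p. 11)] -/
theorem isTypeIBlowup_of_cknATransfer_of_liouvilleL (hL : TypeIliouvilleL) {ν T : ℝ}
    {u : ℝ → EuclideanSpace ℝ (Fin 3) → EuclideanSpace ℝ (Fin 3)}
    {p : ℝ → EuclideanSpace ℝ (Fin 3) → ℝ} (hν : 0 < ν) (hT : 0 < T)
    (hmax : IsMaximalSmoothSolution ν 0 u p T) (hLH : IsLerayHopfOn T ν 0 (u 0) u)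
    (hdec : HasRapidSpatialDecay (u 0))
    (htransfer : ¬ IsTypeIBlowup u T →
      ∀ (tc M : ℕ → ℝ) (xc : ℕ → EuclideanSpace ℝ (Fin 3))
        (v : ℝ → EuclideanSpace ℝ (Fin 3) → EuclideanSpace ℝ (Fin 3)),
        (∀ j, 0 < M j) →
        (∀ j : ℕ,
          Icc (tc j - j * ν / M j ^ 2) (tc j + j * ν / M j ^ 2) ⊆ Ioo (T - T / (j + 1)) T) →
        (∀ j : ℕ, ∀ s ∈ Icc (tc j - j * ν / M j ^ 2) (tc j + j * ν / M j ^ 2), ∀ x,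
          ‖u s x‖ ≤ 2 * M j) →
        (∀ j, M j ≤ 2 * ‖u (tc j) (xc j)‖) →
        ContDiff ℝ (⊤ : ℕ∞) (uncurry v) → (∀ t, VectorCalculus.IsDivFree (v t)) →
        (∀ s t : ℝ, s < t → ∀ x, v t x = heatFlow (v s) (t - s) x - oseenDuhamel 1 s v v t x) →
        (∀ t x, ‖v t x‖ ≤ 2) →
        (∀ s y, Tendsto (fun j => ((M j)⁻¹ • stPull (ν / M j ^ 2) (ν / M j) (tc j) (xc j) u) s y)
          atTop (𝓝 (v s y))) →
        (∀ s y, Tendsto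
          (fun j => fderiv ℝ (((M j)⁻¹ • stPull (ν / M j ^ 2) (ν / M j) (tc j) (xc j) u) s) y)
          atTop (𝓝 (fderiv ℝ (v s) y))) →
        ∃ I : ℝ≥0∞, I < ⊤ ∧ ∀ r : ℝ, 0 < r → ∀ z : ℝ × EuclideanSpace ℝ (Fin 3), cknA r z v ≤ I) :
    IsTypeIBlowup u T :=
  isTypeIBlowup_of_transfer_of_rigidity
    (fun v => ∃ I : ℝ≥0∞, I < ⊤ ∧
      ∀ r : ℝ, 0 < r → ∀ z : ℝ × EuclideanSpace ℝ (Fin 3), cknA r z v ≤ I)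
    hν hT hmax hLH hdec htransfer
    fun v hv hdiv hmild hbd hP => by
      obtain ⟨I, hI, hA⟩ := hP
      exact eternal_eq_zero_of_liouvilleL_of_cknA_le hL v hv hdiv hmild ⟨2, hbd⟩ hI hA 0 0

/-- **The crux modulo (L) and the `A`-transfer, BY NAME.**  If (L) holds (`TypeIliouvilleL`) and,
for every maximal Leray–Hopf solution from rapidly decaying data which is not Type I, the limit of
its Type-II zoom package carries a uniform bound on the scaled local energy `A` over all parabolic
balls, then `TypeIliouvilleNoTypeII` (stmt-NavierStokesRegularity-0056).  For the route
`TypeILiouville`, which pays for (L) as its crux #3, this relocates the Type-II residual from the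
pointwise rate (C3) to an a-priori bound on the scaled local energy near the blow-up (the
`A`-component of Albritton–Barker's C1′). [cite: KochNadirashviliSereginSverak2009, §1 conjecture (L) and §6 (arXiv:0709.3599)] -/
theorem typeIliouvilleNoTypeII_of_cknATransfer_of_liouvilleL (hL : TypeIliouvilleL)
    (htransfer : ∀ (ν T : ℝ), 0 < ν → 0 < T →
      ∀ (u : ℝ → EuclideanSpace ℝ (Fin 3) → EuclideanSpace ℝ (Fin 3))
        (p : ℝ → EuclideanSpace ℝ (Fin 3) → ℝ),
      IsMaximalSmoothSolution ν 0 u p T → IsLerayHopfOn T ν 0 (u 0) u →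
      HasRapidSpatialDecay (u 0) → ¬ IsTypeIBlowup u T →
      ∀ (tc M : ℕ → ℝ) (xc : ℕ → EuclideanSpace ℝ (Fin 3))
        (v : ℝ → EuclideanSpace ℝ (Fin 3) → EuclideanSpace ℝ (Fin 3)),
        (∀ j, 0 < M j) →
        (∀ j : ℕ,
          Icc (tc j - j * ν / M j ^ 2) (tc j + j * ν / M j ^ 2) ⊆ Ioo (T - T / (j + 1)) T) →
        (∀ j : ℕ, ∀ s ∈ Icc (tc j - j * ν / M j ^ 2) (tc j + j * ν / M j ^ 2), ∀ x,
          ‖u s x‖ ≤ 2 * M j) →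
        (∀ j, M j ≤ 2 * ‖u (tc j) (xc j)‖) →
        ContDiff ℝ (⊤ : ℕ∞) (uncurry v) → (∀ t, VectorCalculus.IsDivFree (v t)) →
        (∀ s t : ℝ, s < t → ∀ x, v t x = heatFlow (v s) (t - s) x - oseenDuhamel 1 s v v t x) →
        (∀ t x, ‖v t x‖ ≤ 2) →
        (∀ s y, Tendsto (fun j => ((M j)⁻¹ • stPull (ν / M j ^ 2) (ν / M j) (tc j) (xc j) u) s y)
          atTop (𝓝 (v s y))) →
        (∀ s y, Tendsto
          (fun j => fderiv ℝ (((M j)⁻¹ • stPull (ν / M j ^ 2) (ν / M j) (tc j) (xc j) u) s) y)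
          atTop (𝓝 (fderiv ℝ (v s) y))) →
        ∃ I : ℝ≥0∞, I < ⊤ ∧ ∀ r : ℝ, 0 < r → ∀ z : ℝ × EuclideanSpace ℝ (Fin 3), cknA r z v ≤ I) :
    TypeIliouvilleNoTypeII :=
  fun ν T hν hT u p hmax hLH hdec =>
    isTypeIBlowup_of_cknATransfer_of_liouvilleL hL hν hT hmax hLH hdec
      (htransfer ν T hν hT u p hmax hLH hdec)

end Summit.NavierStokesRegularity.NavierStokesRegularity.Theorems.TypeIliouvilleNoTypeII.TypeIIZoom

end
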